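import Mathlib

/-!
# Line `Sketch` (separable-majorant) for crux `FidelityWitnesses.FidelityThesis` (stmt-MatrixMultiplication-4956) —
stub `stub_generalMajorantLaw`: the GENERAL (test-tensor-free) SEPARABLE MAJORANT LAW

Index types `α` (output slot), `β`, `γ` (input slots) are arbitrary finite types; `Z : α → β → γ → ℂ` is an
arbitrary test tensor with output slices `Z_a := Z a`.

Statement.  Let `S = Σ_l w_l ⊗ u_l ⊗ v_l` (`r` triads) and let `σ = Σ_k p_k (φ_k ⊗ ψ_k)(φ_k ⊗ ψ_k)^*` be a
nonnegative separable mixture of sub-normalised total weight `Σ_k p_k ‖φ_k‖² ‖ψ_k‖² ≤ 1`.  Suppose the product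
span `E = span{u_l ⊗ v_l}` is majorised by `λ σ` in the projector-free form

  `|Σ_{bc} y(b,c) z(b,c)|² ≤ λ ‖y‖² · Σ_k p_k |Σ_{bc} φ_k(b) ψ_k(c) z(b,c)|²`  (`y = Σ_l d_l u_l ⊗ v_l ∈ E`, all `z`),

and the test tensor satisfies `Σ_a |⟨f ⊗ g, Z_a⟩|² ≤ K ‖f‖² ‖g‖²` for all `f, g` (its injective norm² with
respect to `ℓ²` on the output slot is `≤ K`).  Then `|⟨S, Z⟩|² ≤ λ K ‖S‖²`.

Proof.  Slice by slice, `⟨S, Z⟩ = Σ_a Y_a` with `Y_a = ⟨y_a, Z_a⟩`, `y_a = Σ_l w_l(a) u_l ⊗ v_l`, and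
`‖S‖² = Σ_a N_a`, `N_a = ‖y_a‖²`.  The hypothesis at `(d, z) = (w_·(a), Z_a)` gives `|Y_a|² ≤ λ N_a q_a` with
`q_a = Σ_k p_k |⟨φ_k ⊗ ψ_k, Z_a⟩|²`; the weighted Cauchy–Schwarz inequality over `a`
(`Finset.sum_sq_le_sum_mul_sum_of_sq_le_mul`) gives `(Σ_a |Y_a|)² ≤ λ (Σ_a N_a) (Σ_a q_a)`, and
`Σ_a q_a = Σ_k p_k Σ_a |⟨φ_k ⊗ ψ_k, Z_a⟩|² ≤ K Σ_k p_k ‖φ_k‖² ‖ψ_k‖² ≤ K` by the hypothesis on `Z`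
(`genMajorantGML_sliceWeight_le`).  The landed `stub_separableMajorantLaw`
(`Theorems/FidelityWitnessesFidelityThesisStubSeparableMajorantLaw`) is the case `Z = ⟨n,n,n⟩`, `K = 1`
(single-product law).  Supports item `stmt-MatrixMultiplication-4956`; no definitions; Mathlib only.
-/

namespace Summit.MatrixMultiplication.MatrixMultiplication.Theorems

open scoped BigOperators ComplexConjugate

/-- The separable weights of the output slices of a test tensor `Z` sum to at most `K` times the total
weight of `σ`: if `Σ_a |⟨f ⊗ g, Z_a⟩|² ≤ K ‖f‖² ‖g‖²` for all `f, g`, then for `p ≥ 0`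
`Σ_a Σ_k p_k |⟨φ_k ⊗ ψ_k, Z_a⟩|² ≤ K Σ_k p_k ‖φ_k‖² ‖ψ_k‖²` — the hypothesis on `Z` summed against the
mixture weights. [folklore] -/
theorem genMajorantGML_sliceWeight_le {α β γ : Type*} [Fintype α] [Fintype β] [Fintype γ] {m : ℕ}
    (p : Fin m → ℝ) (φ : Fin m → β → ℂ) (ψ : Fin m → γ → ℂ) (K : ℝ) (hp : ∀ k, 0 ≤ p k)
    (Z : α → β → γ → ℂ)
    (hZ : ∀ (f : β → ℂ) (g : γ → ℂ),
      ∑ a, ‖∑ b, ∑ c, f b * g c * Z a b c‖ ^ 2 ≤ K * ((∑ b, ‖f b‖ ^ 2) * ∑ c, ‖g c‖ ^ 2)) :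
    ∑ a, ∑ k, p k * ‖∑ b, ∑ c, φ k b * ψ k c * Z a b c‖ ^ 2 ≤
      K * ∑ k, p k * ((∑ b, ‖φ k b‖ ^ 2) * ∑ c, ‖ψ k c‖ ^ 2) := by
  calc ∑ a, ∑ k, p k * ‖∑ b, ∑ c, φ k b * ψ k c * Z a b c‖ ^ 2
        = ∑ k, p k * ∑ a, ‖∑ b, ∑ c, φ k b * ψ k c * Z a b c‖ ^ 2 := by
        rw [Finset.sum_comm]
        exact Finset.sum_congr rfl fun k _ => (Finset.mul_sum _ _ _).symm
    _ ≤ ∑ k, p k * (K * ((∑ b, ‖φ k b‖ ^ 2) * ∑ c, ‖ψ k c‖ ^ 2)) :=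
        Finset.sum_le_sum fun k _ => mul_le_mul_of_nonneg_left (hZ (φ k) (ψ k)) (hp k)
    _ = K * ∑ k, p k * ((∑ b, ‖φ k b‖ ^ 2) * ∑ c, ‖ψ k c‖ ^ 2) := by
        rw [Finset.mul_sum]
        exact Finset.sum_congr rfl fun k _ => mul_left_comm _ _ _

/-- **General (test-tensor-free) separable majorant law.**  For `r` products `u_l ⊗ v_l` of the two input
legs (arbitrary finite index types), a nonnegative finite mixture `σ = Σ_k p_k (φ_k ⊗ ψ_k)(φ_k ⊗ ψ_k)^*` of
sub-normalised total weight (`Σ_k p_k ‖φ_k‖²‖ψ_k‖² ≤ 1`), `λ ≥ 0` such that the product span is majorised by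
`λσ` in the projector-free form
`|Σ_{bc} y(b,c) z(b,c)|² ≤ λ · ‖y‖² · Σ_k p_k |Σ_{bc} φ_k(b)ψ_k(c) z(b,c)|²` for every `y = Σ_l d_l u_l ⊗ v_l`
in the span and every `z`, and a test tensor `Z` with `Σ_a |⟨f ⊗ g, Z_a⟩|² ≤ K ‖f‖² ‖g‖²` for all `f, g`
(`K ≥ 0`): every tensor `S = Σ_l w_l ⊗ u_l ⊗ v_l` with that input frame has `|⟨S, Z⟩|² ≤ λ·K·‖S‖²`.
(Hypothesis on each output slice, weighted Cauchy–Schwarz over the output slot, and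
`genMajorantGML_sliceWeight_le`.) [folklore] -/
theorem stub_generalMajorantLaw {α β γ : Type*} [Fintype α] [Fintype β] [Fintype γ] {r m : ℕ}
    (w : Fin r → α → ℂ) (u : Fin r → β → ℂ) (v : Fin r → γ → ℂ)
    (p : Fin m → ℝ) (φ : Fin m → β → ℂ) (ψ : Fin m → γ → ℂ) (lam K : ℝ) (hlam : 0 ≤ lam) (hK : 0 ≤ K)
    (hp : ∀ k, 0 ≤ p k)
    (htr : ∑ k, p k * ((∑ b, ‖φ k b‖ ^ 2) * ∑ c, ‖ψ k c‖ ^ 2) ≤ 1)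
    (hmaj : ∀ (d : Fin r → ℂ) (z : β → γ → ℂ),
      ‖∑ b, ∑ c, (∑ l, d l * u l b * v l c) * z b c‖ ^ 2 ≤
        lam * (∑ b, ∑ c, ‖∑ l, d l * u l b * v l c‖ ^ 2) *
          ∑ k, p k * ‖∑ b, ∑ c, φ k b * ψ k c * z b c‖ ^ 2)
    (Z : α → β → γ → ℂ)
    (hZ : ∀ (f : β → ℂ) (g : γ → ℂ),
      ∑ a, ‖∑ b, ∑ c, f b * g c * Z a b c‖ ^ 2 ≤ K * ((∑ b, ‖f b‖ ^ 2) * ∑ c, ‖g c‖ ^ 2)) :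
    ‖∑ a, ∑ b, ∑ c, (∑ l, w l a * u l b * v l c) * Z a b c‖ ^ 2 ≤
      lam * K * ∑ a, ∑ b, ∑ c, ‖∑ l, w l a * u l b * v l c‖ ^ 2 := by
  -- output slices `Y a = ⟨y_a, Z_a⟩`, their weights `N a = ‖y_a‖²`, and the separable weights `q a`
  set Y : α → ℂ := fun a => ∑ b, ∑ c, (∑ l, w l a * u l b * v l c) * Z a b c
  set N : α → ℝ := fun a => ∑ b, ∑ c, ‖∑ l, w l a * u l b * v l c‖ ^ 2
  set q : α → ℝ := fun a => ∑ k, p k * ‖∑ b, ∑ c, φ k b * ψ k c * Z a b c‖ ^ 2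
  -- (ii) the majorant hypothesis on each output slice: `|Y_a|² ≤ λ N_a q_a`
  have hslice : ∀ a, ‖Y a‖ ^ 2 ≤ lam * N a * q a := fun a => hmaj (fun l => w l a) (Z a)
  have hN0 : ∀ a, 0 ≤ N a := fun a =>
    Finset.sum_nonneg fun b _ => Finset.sum_nonneg fun c _ => by positivity
  have hq0 : ∀ a, 0 ≤ q a := fun a =>
    Finset.sum_nonneg fun k _ => mul_nonneg (hp k) (by positivity)
  have hNsum0 : 0 ≤ ∑ a, N a := Finset.sum_nonneg fun a _ => hN0 a
  -- (v) the separable weights sum to at most `K` (hypothesis on `Z` against `p`, then `htr`)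
  have hqsum : ∑ a, q a ≤ K :=
    calc ∑ a, q a ≤ K * ∑ k, p k * ((∑ b, ‖φ k b‖ ^ 2) * ∑ c, ‖ψ k c‖ ^ 2) :=
          genMajorantGML_sliceWeight_le p φ ψ K hp Z hZ
      _ ≤ K * 1 := mul_le_mul_of_nonneg_left htr hK
      _ = K := mul_one K
  -- (iv) weighted Cauchy–Schwarz over the output slot `a`
  have hCS : (∑ a, ‖Y a‖) ^ 2 ≤ (∑ a, lam * N a) * ∑ a, q a :=
    Finset.sum_sq_le_sum_mul_sum_of_sq_le_mul Finset.univ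
      (fun a _ => mul_nonneg hlam (hN0 a)) (fun a _ => hq0 a) (fun a _ => hslice a)
  -- (vi) assemble
  calc ‖∑ a, Y a‖ ^ 2 ≤ (∑ a, ‖Y a‖) ^ 2 := pow_le_pow_left₀ (norm_nonneg _) (norm_sum_le _ _) 2
    _ ≤ (∑ a, lam * N a) * ∑ a, q a := hCS
    _ = lam * (∑ a, N a) * ∑ a, q a := by rw [← Finset.mul_sum]
    _ ≤ lam * (∑ a, N a) * K := mul_le_mul_of_nonneg_left hqsum (mul_nonneg hlam hNsum0)
    _ = lam * K * ∑ a, N a := by ring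

end Summit.MatrixMultiplication.MatrixMultiplication.Theorems
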